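import Mathlib
import Summits.Ventures.FusionMHD.Models.TearingFRS1DeltaPrime
import HarnessLib

/-!
# F3.r3 instance «TearingFRS1»: the certificate IN THE PRINTED VARIABLES — MODEL M is the printed cylindrical
# outer equation (Miyamoto (9.61)) of the printed peaked profile, and `Δ′ = deltaPrime / r_s`

Companion of `TearingFRS1DeltaPrime.lean` (model-6; `models/F3-SCOPING.md` §7/§7b). Until now the link between the
scaled equation `IsScaledOuterSolution` (in `u = r/r_s`, all data rational) and the AS-PRINTED outer equation
`Literature.MathematicalPhysics.MHD.Tearing.IsCylOuterSolution` [Miyamoto2007 §9.4.1 eq. (9.61)] for the AS-PRINTED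
profile was a derivation on paper (F3-SCOPING §7). This file puts it in the kernel:

* `profile r_s j₀ μ₀ : Tearing.CylProfile` — the `ν = 1` peaked profile of Furth–Rutherford–Selberg 1973 /
  [HamEtAl2013 §4] («`q₀ = 1.4`, `λ = 1`»): `j(r) = j₀/(1 + r²/a²)²` with `a² = (7/3) r_s²` (so that `q(r_s) = 2`),
  `B_θ(r) = μ₀ j₀ r /(2(1 + r²/a²))` (Ampère), `q(r) = (7/5)(1 + r²/a²)`, `j′(r)`; written with cleared fractions in
  `(r, r_s)`. CONSISTENCY (proved, not assumed): `hasDerivAt_j` (`djdr = j′`), `ampere` (`(r B_θ)′ = μ₀ r j`),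
  `q_of_Bz` (`q = r B_z/(R₀ B_θ)` whenever `q₀ = 2B_z/(μ₀ j₀ R₀) = 7/5`), `isRationalSurface` (`q(r_s) = 2 = m/n`);
* **`isCylOuterSolution_of_scaled`** — for every `r_s > 0`, `j₀ ≠ 0`, `μ₀ ≠ 0`: if `(Ψ, Ψ′)` is a scaled outer solution
  on `s`, then `r ↦ Ψ(r/r_s)`, `r ↦ Ψ′(r/r_s)/r_s` satisfy the PRINTED equation (9.61) of `profile r_s j₀ μ₀`, mode
  `(m, n) = (2, 1)`, at every `r ≠ 0`, `r² ≠ r_s²` with `r/r_s ∈ s` (pure algebra: `−m μ₀ j′/(r F) = 560/(r_s²(7+3u²)²(u²−1))`);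
* `isDeltaPrime_scale` — `Tearing.IsDeltaPrime ψ ψ′ 1 Δ → Tearing.IsDeltaPrime (ψ(·/r_s)) (ψ′(·/r_s)/r_s) r_s (Δ/r_s)`;
* **`physical_certificate`** — THE SENTENCE IN PRINTED VARIABLES: for every `r_s > 0`, `j₀ μ₀ ≠ 0`, the function
  `ψ(r) = psi(r/r_s)` solves (9.61) for the printed profile on `0 < r < r_s` and on `r > r_s`, is regular at the axis
  (`ψ/r² → a_L⁻¹/r_s²`), vanishes at the conducting wall `r = 6 r_s`, has `ψ(r_s) = 1`, and its printed tearing index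
  exists with `Δ′ = deltaPrime/r_s`, `5.12620 < r_s Δ′ < 5.12624`.
CERTIFIED: all of the above (kernel). MODELLED: MV-7R (zero β, straight cylinder, single helicity; the profile is
used on the whole interval `0 < r < 6 r_s`, i.e. no vacuum region — as in MODEL M). VALIDATED: see
`TearingFRS1DeltaPrime.lean`. Not about any device. [instance data]
-/

noncomputable section

open Set Filter Literature.MathematicalPhysics.MHD
open scoped Topology

namespace Summit.Ventures.FusionMHD.Models

namespace TearingFRS1

/-! ### The printed profile as a `Tearing.CylProfile` (parameters `r_s`, `j₀`, `μ₀`; `a² = 7 r_s²/3`) -/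

/-- The axial current density `j(r) = j₀/(1 + r²/a²)² = j₀ (7r_s²)²/(7r_s² + 3r²)²` (`a² = 7r_s²/3`): the `ν = 1`
peaked profile [HamEtAl2013 §4; Furth–Rutherford–Selberg 1973]. [instance data] -/
def jz (rs j0 : ℝ) (r : ℝ) : ℝ := j0 * (7 * rs ^ 2) ^ 2 / (7 * rs ^ 2 + 3 * r ^ 2) ^ 2

/-- THE PRINTED PROFILE as reduced cylindrical data: `B_θ = μ₀ j₀ r/(2(1 + r²/a²))`, `q = (7/5)(1 + r²/a²)`,
`j′ = dj/dr`, with `a² = 7r_s²/3` (cleared fractions). [instance data] -/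
def profile (rs j0 mu0 : ℝ) : Tearing.CylProfile where
  Bθ r := mu0 * j0 * (7 * rs ^ 2) * r / (2 * (7 * rs ^ 2 + 3 * r ^ 2))
  q r := (7 * rs ^ 2 + 3 * r ^ 2) / (5 * rs ^ 2)
  djdr r := -588 * j0 * rs ^ 4 * r / (7 * rs ^ 2 + 3 * r ^ 2) ^ 3
  mu0 := mu0

variable {rs j0 mu0 : ℝ}

/-- `7r_s² + 3r² > 0` for `r_s ≠ 0`. [instance data] -/
theorem den_pos (hrs : rs ≠ 0) (r : ℝ) : 0 < 7 * rs ^ 2 + 3 * r ^ 2 := by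
  have : 0 < rs ^ 2 := by positivity
  nlinarith [sq_nonneg r]

/-- The printed shapes: `j = j₀/(1 + r²/a²)²`, `B_θ = μ₀ j₀ r/(2(1 + r²/a²))`, `q = (7/5)(1 + r²/a²)` with
`a² = 7 r_s²/3`. [instance data] -/
theorem printed_forms (hrs : rs ≠ 0) (r : ℝ) :
    jz rs j0 r = j0 / (1 + r ^ 2 / (7 * rs ^ 2 / 3)) ^ 2 ∧
      (profile rs j0 mu0).Bθ r = mu0 * j0 * r / (2 * (1 + r ^ 2 / (7 * rs ^ 2 / 3))) ∧
      (profile rs j0 mu0).q r = 7 / 5 * (1 + r ^ 2 / (7 * rs ^ 2 / 3)) := by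
  have hd := (den_pos hrs r).ne'
  have h7 : (7 * rs ^ 2 : ℝ) ≠ 0 := by positivity
  refine ⟨?_, ?_, ?_⟩
  · rw [jz]; field_simp
  · simp only [profile]; field_simp
  · simp only [profile]; field_simp

/-- CONSISTENCY 1: `djdr` IS the derivative of `j`. [instance data] -/
theorem hasDerivAt_j (hrs : rs ≠ 0) (r : ℝ) : HasDerivAt (jz rs j0) ((profile rs j0 mu0).djdr r) r := by
  have hd := (den_pos hrs r).ne'
  have hsq : HasDerivAt (fun x : ℝ => x ^ 2) (2 * r) r := by simpa using hasDerivAt_pow 2 r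
  have h0 : HasDerivAt (fun x : ℝ => 7 * rs ^ 2 + 3 * x ^ 2) (3 * (2 * r)) r := (hsq.const_mul 3).const_add _
  have h1 : HasDerivAt (fun x : ℝ => (7 * rs ^ 2 + 3 * x ^ 2) ^ 2)
      ((2 : ℕ) * (7 * rs ^ 2 + 3 * r ^ 2) ^ (2 - 1) * (3 * (2 * r))) r := h0.pow 2
  have h2 : HasDerivAt (jz rs j0)
      ((0 * (7 * rs ^ 2 + 3 * r ^ 2) ^ 2 - j0 * (7 * rs ^ 2) ^ 2 * ((2 : ℕ) * (7 * rs ^ 2 + 3 * r ^ 2) ^ (2 - 1) * (3 * (2 * r))))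
        / ((7 * rs ^ 2 + 3 * r ^ 2) ^ 2) ^ 2) r :=
    (hasDerivAt_const r (j0 * (7 * rs ^ 2) ^ 2)).div h1 (pow_ne_zero 2 hd)
  refine h2.congr_deriv ?_
  simp only [profile, Nat.cast_ofNat, pow_one, Nat.add_one_sub_one]
  field_simp
  ring

/-- CONSISTENCY 2 (Ampère): `(r B_θ)′ = μ₀ r j`. [instance data] -/
theorem ampere (hrs : rs ≠ 0) (r : ℝ) :
    HasDerivAt (fun r => r * (profile rs j0 mu0).Bθ r) (mu0 * r * jz rs j0 r) r := by
  have hd := (den_pos hrs r).ne'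
  have hsq : HasDerivAt (fun x : ℝ => x ^ 2) (2 * r) r := by simpa using hasDerivAt_pow 2 r
  have h0 : HasDerivAt (fun x : ℝ => 2 * (7 * rs ^ 2 + 3 * x ^ 2)) (2 * (3 * (2 * r))) r :=
    ((hsq.const_mul 3).const_add _).const_mul 2
  have hn : HasDerivAt (fun x : ℝ => mu0 * j0 * (7 * rs ^ 2) * x ^ 2) (mu0 * j0 * (7 * rs ^ 2) * (2 * r)) r :=
    hsq.const_mul _
  have h : HasDerivAt (fun x : ℝ => mu0 * j0 * (7 * rs ^ 2) * x ^ 2 / (2 * (7 * rs ^ 2 + 3 * x ^ 2)))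
      ((mu0 * j0 * (7 * rs ^ 2) * (2 * r) * (2 * (7 * rs ^ 2 + 3 * r ^ 2))
        - mu0 * j0 * (7 * rs ^ 2) * r ^ 2 * (2 * (3 * (2 * r)))) / (2 * (7 * rs ^ 2 + 3 * r ^ 2)) ^ 2) r :=
    hn.div h0 (by positivity)
  have e : (fun y : ℝ => mu0 * j0 * (7 * rs ^ 2) * y ^ 2 / (2 * (7 * rs ^ 2 + 3 * y ^ 2))) =
      fun y => y * (profile rs j0 mu0).Bθ y := by
    funext y; simp only [profile]; ring
  rw [e] at h
  refine h.congr_deriv ?_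
  rw [jz]
  field_simp
  ring

/-- CONSISTENCY 3: `q = r B_z/(R₀ B_θ)` for every `r ≠ 0` as soon as `q₀ = 2B_z/(μ₀ j₀ R₀) = 7/5` (the printed
`q₀ = 1.4`). [instance data] -/
theorem q_of_Bz (hrs : rs ≠ 0) (hj : j0 ≠ 0) (hmu : mu0 ≠ 0) {Bz R0 r : ℝ} (hR : R0 ≠ 0) (hr : r ≠ 0)
    (hq0 : 2 * Bz / (mu0 * j0 * R0) = 7 / 5) :
    (profile rs j0 mu0).q r = r * Bz / (R0 * (profile rs j0 mu0).Bθ r) := by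
  have hd := (den_pos hrs r).ne'
  have hmjR : mu0 * j0 * R0 ≠ 0 := by positivity
  have hBz : Bz = 7 / 10 * (mu0 * j0 * R0) := by
    rw [div_eq_iff hmjR] at hq0
    linarith
  subst hBz
  simp only [profile]
  field_simp
  ring

/-- CONSISTENCY 4: `r_s` is the rational surface of the mode `(2, 1)`: `q(r_s) = 2`. [instance data] -/
theorem isRationalSurface (hrs : 0 < rs) : (profile rs j0 mu0).IsRationalSurface 2 1 rs := by
  refine ⟨hrs, ?_⟩
  simp only [profile]
  push_cast
  field_simp
  ring

/-- `F = (B_θ/r)(n q − m) = 21 μ₀ j₀ (r² − r_s²)/(10 (7 r_s² + 3 r²))` for `r ≠ 0` (`(m, n) = (2, 1)`): vanishes exactly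
at `r = r_s`. [instance data] -/
theorem F_eq (hrs : rs ≠ 0) {r : ℝ} (hr : r ≠ 0) :
    (profile rs j0 mu0).F 2 1 r = 21 * mu0 * j0 * (r ^ 2 - rs ^ 2) / (10 * (7 * rs ^ 2 + 3 * r ^ 2)) := by
  have hd := (den_pos hrs r).ne'
  simp only [Tearing.CylProfile.F, profile]
  push_cast
  field_simp
  ring

/-- THE KEY IDENTITY: `−m μ₀ j′/(r F) = 560/(r_s² (7 + 3u²)² (u² − 1))` at `r = r_s u` (`m = 2`), i.e. in `r`:
`−2 μ₀ j′(r)/(r F(r)) = 560 r_s⁴ /((7r_s² + 3r²)² (r² − r_s²))`. [instance data] -/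
theorem current_term (hrs : rs ≠ 0) (hj : j0 ≠ 0) (hmu : mu0 ≠ 0) {r : ℝ} (hr : r ≠ 0) (hr1 : r ^ 2 ≠ rs ^ 2) :
    -((2 : ℝ) * (profile rs j0 mu0).mu0 * (profile rs j0 mu0).djdr r / (r * (profile rs j0 mu0).F 2 1 r)) =
      560 * rs ^ 4 / ((7 * rs ^ 2 + 3 * r ^ 2) ^ 2 * (r ^ 2 - rs ^ 2)) := by
  have hd := (den_pos hrs r).ne'
  have hr2 : r ^ 2 - rs ^ 2 ≠ 0 := sub_ne_zero.2 hr1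
  rw [F_eq hrs hr]
  simp only [profile]
  field_simp
  ring

/-! ### Scaled solutions are printed solutions -/

/-- **THE BRIDGE.** A scaled outer solution `(Ψ, Ψ′)` of MODEL M on `s` gives a solution of the PRINTED outer equation
[Miyamoto2007 (9.61)] of the printed profile, mode `(2,1)`: `ψ(r) = Ψ(r/r_s)`, `ψ′(r) = Ψ′(r/r_s)/r_s`, at every `r`
of a set `t` with `r/r_s ∈ s`, `r ≠ 0`, `r² ≠ r_s²`. [instance data] -/
theorem isCylOuterSolution_of_scaled (hrs : 0 < rs) (hj : j0 ≠ 0) (hmu : mu0 ≠ 0) {Ψ Ψ' : ℝ → ℝ} {s t : Set ℝ}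
    (hΨ : IsScaledOuterSolution Ψ Ψ' s) (hts : ∀ r ∈ t, r / rs ∈ s ∧ r ≠ 0 ∧ r ^ 2 ≠ rs ^ 2) :
    Tearing.IsCylOuterSolution (profile rs j0 mu0) 2 1 (fun r => Ψ (r / rs)) (fun r => Ψ' (r / rs) / rs) t := by
  intro r hr
  obtain ⟨hu, hr0, hr1⟩ := hts r hr
  have hrs0 : rs ≠ 0 := hrs.ne'
  obtain ⟨h1, h2⟩ := hΨ (r / rs) hu
  have hd : HasDerivAt (fun r : ℝ => r / rs) (1 / rs) r := (hasDerivAt_id r).div_const rs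
  refine ⟨?_, ?_⟩
  · exact (h1.comp r hd).congr_deriv (by ring)
  · have h := (h2.comp r hd).div_const rs
    refine h.congr_deriv ?_
    have hct := current_term (j0 := j0) (mu0 := mu0) hrs0 hj hmu hr0 hr1
    have hden := (den_pos hrs0 r).ne'
    have hr2 : r ^ 2 - rs ^ 2 ≠ 0 := sub_ne_zero.2 hr1
    have hu2 : (r / rs) ^ 2 - 1 ≠ 0 := by
      rw [div_pow, div_sub_one (pow_ne_zero 2 hrs0)]
      exact div_ne_zero hr2 (pow_ne_zero 2 hrs0)
    have h73 : (7 + 3 * (r / rs) ^ 2 : ℝ) ≠ 0 := by positivity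
    -- the printed coefficient equals the scaled one divided by `r_s²`
    have key : ((2 : ℤ) : ℝ) ^ 2 / r ^ 2 - ((2 : ℤ) : ℝ) * (profile rs j0 mu0).mu0 * (profile rs j0 mu0).djdr r
          / (r * (profile rs j0 mu0).F 2 1 r) =
        (4 / (r / rs) ^ 2 + 560 / ((7 + 3 * (r / rs) ^ 2) ^ 2 * ((r / rs) ^ 2 - 1))) / rs ^ 2 := by
      have e1 : ((2 : ℤ) : ℝ) ^ 2 / r ^ 2 - ((2 : ℤ) : ℝ) * (profile rs j0 mu0).mu0 * (profile rs j0 mu0).djdr r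
          / (r * (profile rs j0 mu0).F 2 1 r) = 4 / r ^ 2 + 560 * rs ^ 4 / ((7 * rs ^ 2 + 3 * r ^ 2) ^ 2 * (r ^ 2 - rs ^ 2)) := by
        rw [← hct]; push_cast; ring
      rw [e1]
      rw [div_pow]
      field_simp
    rw [key]
    field_simp

/-! ### Scaling of the printed index -/

/-- `ε ↦ ε/r_s` maps `0⁺` to `0⁺`. [folklore] -/
theorem tendsto_div_nhdsGT (hrs : 0 < rs) : Tendsto (fun ε : ℝ => ε / rs) (𝓝[>] 0) (𝓝[>] 0) := by
  refine tendsto_nhdsWithin_iff.2 ⟨?_, ?_⟩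
  · have : Tendsto (fun ε : ℝ => ε / rs) (𝓝 0) (𝓝 (0 / rs)) := (continuous_id.div_const rs).tendsto 0
    rw [zero_div] at this
    exact tendsto_nhdsWithin_of_tendsto_nhds this
  · filter_upwards [self_mem_nhdsWithin] with ε hε using div_pos hε hrs

/-- SCALING OF `Δ′`: `IsDeltaPrime ψ ψ′ 1 Δ → IsDeltaPrime (ψ(·/r_s)) (ψ′(·/r_s)/r_s) r_s (Δ/r_s)` — the dimensionless
`r_s Δ′` of the scaled problem is `r_s` times the printed `Δ′` in `r`. [instance data] -/
theorem isDeltaPrime_scale (hrs : 0 < rs) {ψ ψ' : ℝ → ℝ} {Δ : ℝ} (h : Tearing.IsDeltaPrime ψ ψ' 1 Δ) :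
    Tearing.IsDeltaPrime (fun r => ψ (r / rs)) (fun r => ψ' (r / rs) / rs) rs (Δ / rs) := by
  obtain ⟨hc, h0, ht⟩ := h
  have hrs0 : rs ≠ 0 := hrs.ne'
  have e1 : rs / rs = 1 := div_self hrs0
  refine ⟨?_, ?_, ?_⟩
  · have hd : ContinuousAt (fun r : ℝ => r / rs) rs := (continuous_id.div_const rs).continuousAt
    exact ContinuousAt.comp_of_eq hc hd e1
  · show ψ (rs / rs) ≠ 0
    rwa [e1]
  · have h2 := (ht.comp (tendsto_div_nhdsGT hrs)).const_mul (1 / rs)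
    rw [show 1 / rs * Δ = Δ / rs by ring] at h2
    refine h2.congr fun ε => ?_
    have e2 : (rs + ε) / rs = 1 + ε / rs := by rw [add_div, e1]
    have e3 : (rs - ε) / rs = 1 - ε / rs := by rw [sub_div, e1]
    show 1 / rs * ((ψ' (1 + ε / rs) - ψ' (1 - ε / rs)) / ψ 1) = (ψ' ((rs + ε) / rs) / rs - ψ' ((rs - ε) / rs) / rs) / ψ (rs / rs)
    rw [e2, e3, e1]
    ring

/-- Likewise for the axis limit: `Ψ(u)/u² → c` as `u → 0⁺` gives `Ψ(r/r_s)/r² → c/r_s²` as `r → 0⁺`. [folklore] -/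
theorem tendsto_axis_scale (hrs : 0 < rs) {Ψ : ℝ → ℝ} {c : ℝ} (h : Tendsto (fun u => Ψ u / u ^ 2) (𝓝[>] 0) (𝓝 c)) :
    Tendsto (fun r => Ψ (r / rs) / r ^ 2) (𝓝[>] 0) (𝓝 (c / rs ^ 2)) := by
  have h2 := (h.comp (tendsto_div_nhdsGT hrs)).div_const (rs ^ 2)
  refine h2.congr' ?_
  filter_upwards [self_mem_nhdsWithin] with r hr
  have hr0 : (r : ℝ) ≠ 0 := ne_of_gt hr
  show Ψ (r / rs) / (r / rs) ^ 2 / rs ^ 2 = Ψ (r / rs) / r ^ 2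
  rw [div_pow]
  field_simp

/-! ### The certificate in printed variables -/

/-- **THE F3.r3 CERTIFICATE IN THE PRINTED VARIABLES.** For every rational-surface radius `r_s > 0` (plasma width
`a = r_s √(7/3)`) and all `j₀, μ₀ ≠ 0`, with `P = profile r_s j₀ μ₀` the printed peaked profile and
`ψ(r) = psi(r/r_s)`, `ψ′(r) = psi'(r/r_s)/r_s`:
`r_s` is the `(2,1)` rational surface of `P`; `ψ` solves the printed outer equation (9.61) of `P` for `(m,n) = (2,1)` on
`0 < r < r_s` and on `r > r_s`; `ψ/r² → a_L⁻¹/r_s²` at the axis (regular, `ψ ∝ r²`); `ψ(6 r_s) = 0` (conducting wall);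
`ψ(r_s) = 1`; and the printed tearing index exists, `Tearing.IsDeltaPrime ψ ψ′ r_s (deltaPrime/r_s)`, with
`5.12620 < r_s Δ′ < 5.12624`. CERTIFIED for MODEL M = this profile on `0 < r < 6 r_s` (no vacuum region), zero β,
straight cylinder, single helicity (MV-7R); not a statement about any device. [instance data] -/
theorem physical_certificate (hrs : 0 < rs) (hj : j0 ≠ 0) (hmu : mu0 ≠ 0) :
    (profile rs j0 mu0).IsRationalSurface 2 1 rs ∧
      Tearing.IsCylOuterSolution (profile rs j0 mu0) 2 1 (fun r => psi (r / rs)) (fun r => psi' (r / rs) / rs) (Ioo 0 rs) ∧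
      Tearing.IsCylOuterSolution (profile rs j0 mu0) 2 1 (fun r => psi (r / rs)) (fun r => psi' (r / rs) / rs) (Ioi rs) ∧
      Tendsto (fun r => psi (r / rs) / r ^ 2) (𝓝[>] 0) (𝓝 (aL⁻¹ / rs ^ 2)) ∧
      psi (6 * rs / rs) = 0 ∧ psi (rs / rs) = 1 ∧
      Tearing.IsDeltaPrime (fun r => psi (r / rs)) (fun r => psi' (r / rs) / rs) rs (deltaPrime / rs) ∧
      (51262 / 10000 : ℝ) < rs * (deltaPrime / rs) ∧ rs * (deltaPrime / rs) < (512624 / 100000 : ℝ) := by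
  have hrs0 : rs ≠ 0 := hrs.ne'
  refine ⟨isRationalSurface hrs, ?_, ?_, tendsto_axis_scale hrs psi_axis_limit, ?_, ?_,
    isDeltaPrime_scale hrs isDeltaPrime_psi, ?_, ?_⟩
  · refine isCylOuterSolution_of_scaled hrs hj hmu psi_outer_left fun r hr => ⟨?_, hr.1.ne', ?_⟩
    · exact ⟨div_pos hr.1 hrs, (div_lt_one hrs).2 hr.2⟩
    · intro h; have := abs_eq_abs.1 ((sq_eq_sq_iff_abs_eq_abs r rs).1 h)
      rcases this with h1 | h1 <;> linarith [hr.1, hr.2]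
  · refine isCylOuterSolution_of_scaled hrs hj hmu psi_outer_right fun r hr => ⟨?_, ?_, ?_⟩
    · show 1 < r / rs
      exact (one_lt_div hrs).2 hr
    · have : rs < r := hr
      linarith
    · intro h; have := abs_eq_abs.1 ((sq_eq_sq_iff_abs_eq_abs r rs).1 h)
      have hr' : rs < r := hr
      rcases this with h1 | h1 <;> linarith
  · rw [mul_div_assoc, div_self hrs0, mul_one]; exact psi_wall
  · rw [div_self hrs0]; exact psi_one
  · rw [mul_div_cancel₀ _ hrs0]; exact deltaPrime_bounds.1
  · rw [mul_div_cancel₀ _ hrs0]; exact deltaPrime_bounds.2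

end TearingFRS1

end Summit.Ventures.FusionMHD.Models

end
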